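import Summits.ResolutionOfSingularities.ResolutionOfSingularities.Theorems.EquisingularLiftEquisingularLiftSectionKer
import Summits.ResolutionOfSingularities.ResolutionOfSingularities.Theorems.EquisingularLiftEquisingularLiftSectionOfSmooth
import Summits.ResolutionOfSingularities.ResolutionOfSingularities.Theorems.EquisingularLiftEquisingularLiftPointOfIsClosed
import Mathlib.AlgebraicGeometry.Morphisms.Flat
import HarnessLib

/-!
# `EquisingularLift`, line `Sketch` v9 — SECTION STEP: sections of the smooth locus are admissible horizontal centres

Crux `stmt-ResolutionOfSingularities-15660` = `Theses.EquisingularLift.EquisingularLift`; helper (a) of the lead's list for the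
research stub `stub_horizResolution_three` (2026-08-26T19:22Z): the registered «HorizChain» of skeleton v9 admits as centre of a
step `X'' = Bl_C X' → X'` any ideal sheaf `C` with `V(C)` REGULAR, `V(C) → Spec O` FLAT, and a point of the special fibre OFF
`V(C)`. This file packages the point case (T1 of `L/w45b/CRUX-PLAN.md` §3): the ideal sheaf `ker s` of a SECTION `s` of
`r' : X' → Spec O` is such a centre.

* `section_horizCentre` — `O` a DVR, `r'` separated, `s ≫ r' = 𝟙`: `V(ker s)` is regular (`≅ Spec O`, p167199
  `section_isClosedImmersion_and_isRegular_ker`), `V(ker s) → Spec O` is flat (it is an isomorphism), and every point of the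
  special fibre other than `s(s₀)` lies off `V(ker s)` (the support of `ker s` is `s(Spec O)`, which meets the special fibre
  only in `s(s₀)`).
* `exists_section_horizCentre` — with `O` moreover complete with algebraically closed residue field and `r'` locally of finite
  type: through every CLOSED point `x₀` of the special fibre lying in an open `U ⊆ X'` on which `r'` is smooth there is such a
  section with `s(s₀) = x₀` (closed points of the special fibre are `κ`-rational, p163325 `exists_point_of_isClosed`; Hensel's
  lemma for smooth morphisms, p162938 `exists_section_of_smooth`, EGA IV₄ 18.5.17).

References: A. Grothendieck, J. Dieudonné, *EGA IV₄*, Publ. Math. IHÉS 32 (1967), Thm. 18.5.17; Q. Liu, *Algebraic Geometry and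
Arithmetic Curves*, OUP 2002, §8.1.
-/

set_option linter.dupNamespace false -- mandated namespace `Summit.<Summit>.<Problem>` of this single-conjunct summit
set_option linter.overlappingInstances false -- the signatures carry both [IsDomain O] and [IsDiscreteValuationRing O]

noncomputable section

namespace Summit.ResolutionOfSingularities.ResolutionOfSingularities.Cruxes.EquisingularLift.StrataSplit

open CategoryTheory CategoryTheory.Limits AlgebraicGeometry TopologicalSpace Topology
open IsLocalRing Literature.AlgebraicGeometry.Resolution

/-- **SECTION STEP: the ideal of a section is an admissible horizontal centre.** Let `O` be a discrete valuation ring,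
`r' : X' → Spec O` separated and `s` a section of `r'`. Then `V(ker s)` is a regular scheme, `V(ker s) → Spec O` is flat, and a
point of the special fibre different from `s(s₀)` is not in the support of `ker s`. [folklore] -/
theorem section_horizCentre : ∀ (O : Type) [CommRing O] [IsDomain O] [IsDiscreteValuationRing O] (X' : AlgebraicGeometry.Scheme.{0}) (r' : X' ⟶ AlgebraicGeometry.Spec (.of O)) [AlgebraicGeometry.IsSeparated r'] (s : AlgebraicGeometry.Spec (.of O) ⟶ X'), CategoryTheory.CategoryStruct.comp s r' = CategoryTheory.CategoryStruct.id _ → Literature.AlgebraicGeometry.Resolution.Scheme.IsRegular s.ker.subscheme ∧ AlgebraicGeometry.Flat (CategoryTheory.CategoryStruct.comp s.ker.subschemeι r') ∧ ∀ x : X', r' x = IsLocalRing.closedPoint O → x ≠ s (IsLocalRing.closedPoint O) → x ∉ (s.ker.support : Set X') := by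
  intro O _ _ _ X' r' _ s hs
  obtain ⟨hci, hreg, -, hsupp⟩ := section_isClosedImmersion_and_isRegular_ker O X' r' s hs
  haveI := hci
  refine ⟨hreg, ?_, ?_⟩
  · -- `V(ker s) → Spec O` is an isomorphism (inverse to `s.toImage`), in particular flat
    -- adapted from `flat_exceptional_of_isBlowup_section` (same line)
    have h1 : s.toImage ≫ s.ker.subschemeι ≫ r' = 𝟙 _ := by
      rw [Scheme.Hom.toImage_imageι_assoc]; exact hs
    rw [IsIso.eq_inv_of_hom_inv_id h1]
    infer_instance
  · -- the support of `ker s` is `s(Spec O)`, which meets the special fibre only in `s(s₀)`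
    intro x hx hne hmem
    rw [hsupp] at hmem
    obtain ⟨t, rfl⟩ := hmem
    apply hne
    have ht : r' (s t) = t := by
      rw [← Scheme.Hom.comp_apply, hs]; rfl
    rw [← ht, hx]

/-- **SECTION STEP through a closed point of the smooth locus.** Let `O` be a complete discrete valuation ring with
algebraically closed residue field, `r' : X' → Spec O` separated and locally of finite type, `U ⊆ X'` an open on which `r'` is
smooth, and `x₀ ∈ U` a closed point of `X'` on the special fibre. Then there is a section `s` of `r'` through `x₀` whose ideal
sheaf is an admissible horizontal centre: `V(ker s)` regular, flat over `Spec O`, and missing every point `≠ x₀` of the special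
fibre. [cite: Grothendieck1967, Thm. 18.5.17] -/
theorem exists_section_horizCentre : ∀ (O : Type) [CommRing O] [IsDomain O] [IsDiscreteValuationRing O] [IsAdicComplete (IsLocalRing.maximalIdeal O) O] [IsAlgClosed (IsLocalRing.ResidueField O)] (X' : AlgebraicGeometry.Scheme.{0}) (r' : X' ⟶ AlgebraicGeometry.Spec (.of O)) [AlgebraicGeometry.IsSeparated r'] [AlgebraicGeometry.LocallyOfFiniteType r'] (U : X'.Opens), AlgebraicGeometry.Smooth (CategoryTheory.CategoryStruct.comp U.ι r') → ∀ x₀ : X', IsClosed ({x₀} : Set X') → x₀ ∈ U → r' x₀ = IsLocalRing.closedPoint O → ∃ s : AlgebraicGeometry.Spec (.of O) ⟶ X', CategoryTheory.CategoryStruct.comp s r' = CategoryTheory.CategoryStruct.id _ ∧ s (IsLocalRing.closedPoint O) = x₀ ∧ Literature.AlgebraicGeometry.Resolution.Scheme.IsRegular s.ker.subscheme ∧ AlgebraicGeometry.Flat (CategoryTheory.CategoryStruct.comp s.ker.subschemeι r') ∧ ∀ x : X', r' x = IsLocalRing.closedPoint O → x ≠ x₀ → x ∉ (s.ker.support : Set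 X') := by
  intro O _ _ _ _ _ X' r' _ _ U hU x₀ hcl hxU hrx
  -- the closed point `x₀` of the special fibre is `κ`-rational
  obtain ⟨x, hx, hrange⟩ := exists_point_of_isClosed O X' r' inferInstance x₀ hcl hrx
  have hxU' : Set.range x ⊆ (U : Set X') := by
    rw [hrange, Set.singleton_subset_iff]; exact hxU
  -- Hensel: extend the `κ`-point to a section of `r'`
  obtain ⟨s, hs, hsx⟩ := exists_section_of_smooth O X' r' U hU x hxU' hx
  have hs0 : s (closedPoint O) = x₀ := by
    have h1 : Spec.map (CommRingCat.ofHom (residue O)) (closedPoint (ResidueField O)) = closedPoint O :=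
      IsLocalRing.PrimeSpectrum.comap_residue O _
    have h2 : s (closedPoint O) ∈ Set.range x := by
      rw [← h1, ← Scheme.Hom.comp_apply, hsx]
      exact ⟨_, rfl⟩
    rw [hrange] at h2
    exact h2
  obtain ⟨hreg, hflat, hoff⟩ := section_horizCentre O X' r' s hs
  refine ⟨s, hs, hs0, hreg, hflat, fun y hy hne => hoff y hy ?_⟩
  rwa [hs0]

end Summit.ResolutionOfSingularities.ResolutionOfSingularities.Cruxes.EquisingularLift.StrataSplit

end
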